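import Summits.KontsevichZagierPeriods.KontsevichZagierPeriods.Theorems.TerasomaMultiplicationMultiplicationAccessibleDivPullback
import Summits.KontsevichZagierPeriods.KontsevichZagierPeriods.Theorems.TerasomaMultiplicationMultiplicationAccessibleCornerFieldGen

/-!
# Gradient of the geometric mean in the corner blow-up chart (all dimensions `p = n + 2`)

Crux `MultiplicationAccessible`, line `shifted-family-prime-sieve`, design `GeneralPDesign.md` (route R2):
the partial derivatives of `Z(u) = (∏_k T u k)^(1/p)`, `T u k = 1 − y Θ u k`, along the chart coordinates:
`∂_{θ_i} Z = (Z y/p)(1/T₀ − 1/T_{i+1})`, `∂_y Z = −(Z/p) Σ_k Θ_k/T_k` (the cube slices `∂_{t_k} ζ = ζ/(p t_k)`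
transported by the chain rule through the chart, `DivPullback.hasDerivAt_comp_chart_*`), and the
bookkeeping identity `∇Z · Ỹ = −(Z y^(n+1)/p) Σ_k Z_k/T_k` for the adjugate field.
-/

noncomputable section

open Finset Real
open scoped BigOperators

namespace Summit.KontsevichZagierPeriods.TerasomaMultiplication.MultiplicationAccessible

namespace CornerZeta

variable {n : ℕ}

/-- The cube slice of the geometric mean: `∂_{t_k} (∏ t)^(1/p) = ζ/(p t_k)`. [folklore] -/
theorem hasDerivAt_geomMean_slice (t : Fin (n + 2) → ℝ) (ht : ∀ i, 0 < t i) (k : Fin (n + 2)) :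
    HasDerivAt (fun a => (∏ i, Function.update t k a i) ^ (1 / ((n:ℝ) + 2)))
      ((∏ i, t i) ^ (1 / ((n:ℝ) + 2)) / (((n:ℝ) + 2) * t k)) (t k) := by
  set T' := ∏ j : Fin (n + 1), t (k + j.succ) with hT'
  have hT'0 : 0 < T' := Finset.prod_pos fun j _ => ht _
  have hTT : t k * T' = ∏ i, t i := CornerField.mul_prod_add_succ t k
  have hfun : (fun a => (∏ i, Function.update t k a i) ^ (1 / ((n:ℝ) + 2))) =
      fun a => (a * T') ^ (1 / ((n:ℝ) + 2)) := by
    funext a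
    congr 1
    rw [← CornerField.mul_prod_add_succ _ k, Function.update_self]
    simp only [hT']
    congr 1
    exact Finset.prod_congr rfl fun j _ => Function.update_of_ne (CornerField.add_succ_ne k j) _ _
  rw [hfun]
  have h := ((hasDerivAt_id (t k)).mul_const T').rpow_const (p := 1 / ((n:ℝ) + 2))
    (Or.inl (by simpa using (mul_pos (ht k) hT'0).ne'))
  refine h.congr_deriv ?_
  simp only [id, one_mul]
  rw [Real.rpow_sub_one (mul_pos (ht k) hT'0).ne', hTT, ← hTT]
  field_simp

/-- **`∇Z · Ỹ` bookkeeping**: with `∂_{θ_i}Z = c (1/T₀ − 1/T_{i+1})`, `∂_yZ = −(c/y) Σ_k Θ_k/T_k`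
(`c = Z y / p`), `Θ₀ = 1 − Σθ_i`, `Θ_{i+1} = θ_i`, and the adjugate components
`Ỹ_{θ_i} = y^n (ζ_{i+1} − θ_i Σζ)`, `Ỹ_y = y^(n+1) Σζ`, one has `∇Z·Ỹ = −c·y^n·Σ_k ζ_k/T_k`. [folklore] -/
theorem grad_dot_adj (θ : Fin (n + 1) → ℝ) (Θv Tv ζv : Fin (n + 2) → ℝ) (c y : ℝ) (hy : y ≠ 0)
    (hΘ0 : Θv 0 = 1 - ∑ i, θ i) (hΘs : ∀ i : Fin (n + 1), Θv i.succ = θ i) :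
    (∑ i : Fin (n + 1), (c * (1 / Tv 0 - 1 / Tv i.succ)) * (y ^ n * (ζv i.succ - θ i * ∑ k, ζv k))) +
      (-(c / y) * ∑ k, Θv k / Tv k) * (y ^ (n + 1) * ∑ k, ζv k) =
      -(c * y ^ n) * ∑ k, ζv k / Tv k := by
  rw [Fin.sum_univ_succ (fun k => Θv k / Tv k), Fin.sum_univ_succ (fun k => ζv k / Tv k), hΘ0]
  simp only [hΘs]
  set G := ∑ k, ζv k with hG
  have hG' : G = ζv 0 + ∑ i : Fin (n + 1), ζv i.succ := Fin.sum_univ_succ ζv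
  set S1 := ∑ i : Fin (n + 1), ζv i.succ with hS1
  set S2 := ∑ i : Fin (n + 1), θ i with hS2
  set S3 := ∑ i : Fin (n + 1), ζv i.succ / Tv i.succ with hS3
  set S4 := ∑ i : Fin (n + 1), θ i / Tv i.succ with hS4
  have hA : ∑ i : Fin (n + 1), (c * (1 / Tv 0 - 1 / Tv i.succ)) * (y ^ n * (ζv i.succ - θ i * G)) =
      c * y ^ n * (S1 / Tv 0 - S2 * G / Tv 0 - S3 + G * S4) := by
    have h : ∀ i ∈ (Finset.univ : Finset (Fin (n + 1))),
        (c * (1 / Tv 0 - 1 / Tv i.succ)) * (y ^ n * (ζv i.succ - θ i * G)) =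
        c * y ^ n / Tv 0 * ζv i.succ - c * y ^ n * G / Tv 0 * θ i - c * y ^ n * (ζv i.succ / Tv i.succ) +
          c * y ^ n * G * (θ i / Tv i.succ) := fun i _ => by ring
    rw [Finset.sum_congr rfl h, Finset.sum_add_distrib, Finset.sum_sub_distrib, Finset.sum_sub_distrib,
      ← Finset.mul_sum, ← Finset.mul_sum, ← Finset.mul_sum, ← Finset.mul_sum]
    simp only [← hS1, ← hS2, ← hS3, ← hS4]
    field_simp
  rw [hA, pow_succ]
  field_simp
  rw [hG']
  ring

end CornerZeta

open CornerZeta in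
/-- **Gradient of `Z` along the chart coordinates** (all `p = n + 2`). [cite: KontsevichZagier2001, §1.2] -/
theorem cornerZetaGradGen : ∀ (n : ℕ) (Θ T : (Fin (n + 2) → ℝ) → Fin (n + 2) → ℝ) (Z : (Fin (n + 2) → ℝ) → ℝ),
    (∀ u, Θ u 0 = 1 - ∑ i : Fin (n + 1), u (Fin.castSucc i)) → (∀ u (i : Fin (n + 1)), Θ u i.succ = u (Fin.castSucc i)) →
    (∀ u k, T u k = 1 - u (Fin.last (n + 1)) * Θ u k) →
    (∀ u, Z u = (∏ k, T u k) ^ (1 / ((n:ℝ) + 2))) →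
    ∀ u ∈ {u : Fin (n + 2) → ℝ | (∀ i : Fin (n + 1), 0 < u (Fin.castSucc i)) ∧ ∑ i : Fin (n + 1), u (Fin.castSucc i) < 1 ∧ 0 < u (Fin.last (n + 1)) ∧ u (Fin.last (n + 1)) * (1 - ∑ i : Fin (n + 1), u (Fin.castSucc i)) < 1 ∧ ∀ i : Fin (n + 1), u (Fin.last (n + 1)) * u (Fin.castSucc i) < 1},
      ∃ zi : Fin (n + 2) → ℝ, (∀ j, HasDerivAt (fun b => Z (Function.update u j b)) (zi j) (u j)) ∧
        (∀ i : Fin (n + 1), zi (Fin.castSucc i) = Z u * u (Fin.last (n + 1)) / ((n:ℝ) + 2) * (1 / T u 0 - 1 / T u i.succ)) ∧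
        zi (Fin.last (n + 1)) = -(Z u / ((n:ℝ) + 2)) * ∑ k, Θ u k / T u k := by
  intro n Θ T Z hΘ0 hΘs hT hZ u hu
  obtain ⟨hθpos, hθsum, hy0, hyθ0, hyθ⟩ := hu
  set y := u (Fin.last (n + 1)) with hydef
  set p : ℝ := (n:ℝ) + 2 with hpdef
  have hp : 0 < p := by positivity
  -- positivity of the box coordinates
  have hT0 : ∀ k, 0 < T u k := by
    intro k
    refine Fin.cases ?_ (fun i => ?_) k
    · rw [hT, hΘ0]; linarith
    · rw [hT, hΘs]; nlinarith [hyθ i, hθpos i]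
  -- the chart in the form of the DivPullback lemmas
  have hT0' : ∀ u', T u' 0 = 1 - u' (Fin.last (n + 1)) * (1 - ∑ j : Fin (n + 1), u' (Fin.castSucc j)) :=
    fun u' => by rw [hT, hΘ0]
  have hTs' : ∀ u' (j : Fin (n + 1)), T u' j.succ = 1 - u' (Fin.last (n + 1)) * u' (Fin.castSucc j) :=
    fun u' j => by rw [hT, hΘs]
  -- the geometric mean on the cube and its Fréchet derivative at `T u`
  set ζt : (Fin (n + 2) → ℝ) → ℝ := fun t => (∏ i, t i) ^ (1 / p) with hζt
  have hZ' : ∀ u', Z u' = ζt (T u') := fun u' => by rw [hZ]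
  have hdiff : DifferentiableAt ℝ ζt (T u) := by
    have hprod : DifferentiableAt ℝ (fun t' : Fin (n + 2) → ℝ => ∏ i, t' i) (T u) :=
      (HasFDerivAt.finsetProd (u := Finset.univ) fun i _ => (differentiableAt_apply i (T u)).hasFDerivAt).differentiableAt
    exact hprod.rpow_const (Or.inl (Finset.prod_pos fun i _ => hT0 i).ne')
  set L := fderiv ℝ ζt (T u) with hL
  have hLd : HasFDerivAt ζt L (T u) := hdiff.hasFDerivAt
  -- its values on the coordinate directions
  have hLk : ∀ k, L (Pi.single k 1) = Z u / (p * T u k) := by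
    intro k
    have hs := hasDerivAt_geomMean_slice (T u) hT0 k
    have hc : HasDerivAt (ζt ∘ Function.update (T u) k) (L (Pi.single k 1)) (T u k) := by
      have hLd' : HasFDerivAt ζt L (Function.update (T u) k (T u k)) := by rwa [Function.update_eq_self]
      exact hLd'.comp_hasDerivAt (T u k) (hasDerivAt_update (T u) k (T u k))
    have := hc.unique hs
    rw [this, hZ]
  refine ⟨fun j => Fin.lastCases (-((1 - ∑ i : Fin (n + 1), u (Fin.castSucc i)) * L (Pi.single 0 1) +
      ∑ i : Fin (n + 1), u (Fin.castSucc i) * L (Pi.single i.succ 1)))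
      (fun i => u (Fin.last (n + 1)) * L (Pi.single 0 1) - u (Fin.last (n + 1)) * L (Pi.single i.succ 1)) j,
    fun j => ?_, fun i => ?_, ?_⟩
  · refine Fin.lastCases ?_ (fun i => ?_) j
    · simp only [Fin.lastCases_last]
      have h := DivPullback.hasDerivAt_comp_chart_y T hT0' hTs' u ζt L hLd
      simp only [← hZ'] at h
      exact h
    · simp only [Fin.lastCases_castSucc]
      have h := DivPullback.hasDerivAt_comp_chart_theta T hT0' hTs' u ζt L hLd i
      simp only [← hZ'] at h
      exact h
  · simp only [Fin.lastCases_castSucc, hLk]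
    field_simp
    ring
  · simp only [Fin.lastCases_last, hLk, Fin.sum_univ_succ, hΘ0, hΘs]
    have h : ∀ i : Fin (n + 1), u (Fin.castSucc i) * (Z u / (p * T u i.succ)) =
        Z u / p * (u (Fin.castSucc i) / T u i.succ) := fun i => by ring
    simp only [h, ← Finset.mul_sum]
    ring
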